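import Summits.HodgeConjecture.HodgeConjecture.Theses.IncidenceNodePeeling

/-!
# Route IncidenceNodePeeling — `Assembly` (assembly item stmt-HodgeConjecture-2353)

The assembly item of route `IncidenceNodePeeling`,

  HCMovablePairs → HCRigidPairs → HypersurfaceMiddleReduction → HCNonHypersurfaces → (Hodge models) → HodgeConjecture,

is the route's deciding theorem `IncidenceNodePeeling.closes` curried: its hypotheses are exactly the route items
named in the item (in another order), the Hodge-models antecedent being the route decl `HodgeModels`
unfolded (`∀ n X, nonempty_hodgeModel n X`, definitionally).  Pure logic over the route file; no
other import, no named-fact hypothesis, no sorry.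
-/

-- `Summit.HodgeConjecture.HodgeConjecture.Theorems` is the mandated namespace (single-problem
-- summit: Problem = Summit), which `linter.dupNamespace` flags on every declaration; the lakefile
-- turns the linter off tree-wide (weak option), restated here so stand-alone elaboration is
-- warning-free too.
set_option linter.dupNamespace false

namespace Summit.HodgeConjecture.HodgeConjecture.Theorems

/-- **Item stmt-HodgeConjecture-2353 (`Assembly`), route `IncidenceNodePeeling`**: the route's items imply the
Hodge conjecture — literally the deciding theorem `IncidenceNodePeeling.closes`, curried (the Hodge-models
antecedent is the route decl `HodgeModels` unfolded).  The type is the route decl `Summit.HodgeConjecture.HodgeConjecture.Theses.IncidenceNodePeeling.Assembly`.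
[cite: Thomas2005Nodes, §2] -/
theorem incidenceNodePeeling_assembly_proof :
    Summit.HodgeConjecture.HodgeConjecture.Theses.IncidenceNodePeeling.Assembly :=
  fun h₁ h₂ h₄ h₅ hM ↦
    Summit.HodgeConjecture.HodgeConjecture.Theses.IncidenceNodePeeling.closes h₁ h₂ hM h₄ h₅

end Summit.HodgeConjecture.HodgeConjecture.Theorems
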